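import Summits.NavierStokesRegularity.NavierStokesRegularity.Theorems.ScenarioCensusRowF1ax
import Summits.NavierStokesRegularity.NavierStokesRegularity.Theorems.ScenarioCensusRowA7h
import Summits.NavierStokesRegularity.NavierStokesRegularity.Theorems.ScenarioCensusRowF1StretchedZoom
import Summits.NavierStokesRegularity.NavierStokesRegularity.Theorems.DssFarFieldSlavingBlowupTypeIDssProfileSimilarityEnstrophyBeltramiLiouville
import Summits.NavierStokesRegularity.NavierStokesRegularity.Theorems.SqueezeCycleSingularZoomWindow
import Summits.NavierStokesRegularity.NavierStokesRegularity.Theorems.ClockStretchingLawClockCeilingZoomDerivLimit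
import Summits.NavierStokesRegularity.NavierStokesRegularity.Theorems.PoloidalWindowDoorPoloidalWindowRigidityVorticityTranslate
import Summits.NavierStokesRegularity.NavierStokesRegularity.Theorems.HalfSpaceWindowDoorCirculationCarryingRigidityWholeSpaceMaxPrinciple
import Literature.Analysis.FluidPDE.TypeIAncientMild
import Literature.Analysis.FluidPDE.WholeSpaceIBP
import Literature.Analysis.FluidPDE.ClassicalSolutionCalculus
import Literature.Analysis.FluidPDE.VorticityEquation
import Literature.Analysis.FluidPDE.TypeIAncientMildClassical
import Summits.NavierStokesRegularity.NavierStokesRegularity.Theorems.DssFarFieldSlavingBlowupTypeIDssProfileSimilarityEnstrophyCrossFlowNoDecayOne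
import Summits.NavierStokesRegularity.NavierStokesRegularity.Theorems.DssFarFieldSlavingBlowupTypeIDssProfileSimilarityEnstrophyTimeOnlyThreshold
import HarnessLib
import Summits.NavierStokesRegularity.NavierStokesRegularity.Theorems.ScenarioCensusRowF1ThinTop

/-!
# Census row F1, the EVENT SOCKET on the volume axis (cells F1Σth / F1Σvo / F1Ξth / F1Ξvo, generic F1[P]th/vo; floors RΣS / PΣS / RΞS / PΞS) — LINE 30 «event-socket» port,
# part 1/4: §6 THE EVENT SOCKET — scale-invariant order-1 jets, open EVENTS, event slices, event-fat times, the kill interface; elementary properties; the physical jet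
# under the zoom; joint continuity of the ancient jet.  §1–§5 of the line are LINE 27/28/29 VERBATIM and are taken BY NAME from the landed liouville-socket / sharp-top /
# thin-top ports (`open …LiouvilleSocket …SharpTop …ThinTop`; not re-declared)

Re-homed for the scenario census (typer seat ns-census-typer-1 g9; the cells F1Σth / F1Σvo / F1Ξth / F1Ξvo (+ generic F1[P]th/vo) and the floors RΣS / PΣS / RΞS /
PΞS are MEMBERS OF RECORD «DECIDED IN KERNEL IN FILES» of row F1 since census v1.92 (critic idea-crit-3 g8 PASS 06:47:48Z — no price; ref ns-census-ref g11 PRE-CHECK ✓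
§16.30 item 58; lead-presearch label item 58); this port makes them TREE-decided): VERBATIM PORT of the NEW sections (§6–§8) of ns-idea-3 LINE 30 «event-socket»,
`pub/ideators/ns-idea-3/lines/event-socket/line-event-socket.lean` sha16 6529f3492cb49b94 (1484 l., lean check rc 0, 0 sorry; its §1–§5 = LINE 27/28/29 VERBATIM,
taken BY NAME from `ScenarioCensusRowF1Socket*` / `…SharpTop*` / `…ThinTop*`), split for the 400-line rule into `ScenarioCensusRowF1EventSocket` (§6 vocabulary) →
`…EventSocketTransfer` (§6 transfer + engine) → `…EventSocketEvents` (§7) → `…EventSocketRows` (§8 + census KEYS).  Lean text VERBATIM in namespace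
`…Theorems.ScenarioCensus.EventSocket` (the line's `…Cruxes.ScenarioCensusRowF1.EventSocketLine` re-homed) with `open …LiouvilleSocket …SharpTop …ThinTop`; port
edits: `@[conjecture]` on the residuals `StretchSlack` / `CrossFlowSlack` (≡ `ScenarioCensus.Row_F1`, OPEN), one-line docstrings added where missing (gate lint); `cross_smul_smul` is the tree's `UnthreadedRigidity.ThreadingJets.cross_smul_smul` taken BY NAME (review p713151).
Statements untouched.

No census VALUE is moved here (row F1 stays OPEN-WITH-LINE; the members become TREE-decided by name); NS regularity is NOT proved; `Row_F1` is untouched (zero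
movement, `evSlack_iff_rowF1` / `stretchSlack_iff_rowF1` / `crossFlowSlack_iff_rowF1`); no summit statement is proved by this file. Lemmas that restate already-landed tree declarations are taken BY NAME (gate lint `dedup.landed`): `fderiv_smul_stPull_apply` = `InviscidTop.fderiv_smul_stPull_apply`, `fderiv_smul_stPull` = `InviscidTop.fderiv_smul_stPull`, `fderiv_fderiv_smul_stPull` = `InviscidTop.fderiv_fderiv_smul_stPull`, `tendsto_clm_of_tendsto_apply` = `InviscidTop.tendsto_clm_of_tendsto_apply`, `tendsto_fderiv_fderiv_apply_of_bound` = `InviscidTop.tendsto_fderiv_fderiv_apply_of_bound`, `tendsto_fderiv_fderiv_of_bound` = `InviscidTop.tendsto_fderiv_fderiv_of_bound`, `tendsto_fderiv_fderiv_of_typeI_seq_Ioo` = `InviscidTop.tendsto_fderiv_fderiv_of_typeI_seq_Ioo`, `fderiv3_smul_stPull` = `FrozenTop.fderiv3_smul_stPull`, `tendsto_fderiv3_of_typeI_seq_Ioo` = `FrozenTop.tendsto_fderiv3_of_typeI_seq_Ioo`, `tendsto_physicalTime` = `ColumnarTop.tendsto_physicalTime`, `eventually_fast` = `ColumnarTop.eventually_fast`,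 `sqrt_timeLag` = `StretchedTop.sqrt_timeLag`, `forall_of_forall_ne_zero` = `StretchedTop.forall_of_forall_ne_zero`, `radius_eq` = `FrozenTop.radius_eq`, `jointCond_everywhere₆` = `FrozenTop.jointCond_everywhere₄`, `continuousOn_quad` = `IntegratedStretch.continuousOn_quad`, `sqrt_nu_timeLag` = `IntegratedStretch.sqrt_nu_timeLag`, `sing_of_not_bounded` = `InviscidTop.sing_of_not_bounded`, `exists_singularZoom_package₃` = `FrozenTop.exists_singularZoom_package₃`, `lapD_eq_zero_of_eq_zero` = `FrozenTop.lapD_eq_zero_of_eq_zero`, `measurableSet_top` = `IntegratedStretch.measurableSet_top`, `cross_smul_smul` = `UnthreadedRigidity.ThreadingJets.cross_smul_smul`.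
-/

-- the summit and its single problem share the name `NavierStokesRegularity` (D-0017 nested layout)
set_option linter.dupNamespace false

noncomputable section

open MeasureTheory Set Function Filter TopologicalSpace Metric
open scoped Topology NNReal ENNReal InnerProductSpace RealInnerProductSpace Laplacian

namespace Summit.NavierStokesRegularity.NavierStokesRegularity.Theorems.ScenarioCensus.EventSocket

open Literature.Analysis Literature.Analysis.FluidPDE
open Summit.NavierStokesRegularity.NavierStokesRegularity.Theorems
open Summit.NavierStokesRegularity.NavierStokesRegularity.Theorems.ScenarioCensus.LiouvilleSocket
open Summit.NavierStokesRegularity.NavierStokesRegularity.Theorems.ScenarioCensus.SharpTop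
open Summit.NavierStokesRegularity.NavierStokesRegularity.Theorems.ScenarioCensus.ThinTop

/-! ## §6 THE EVENT SOCKET: scale-invariant ORDER-1 JETS, open EVENTS, event slices, event-fat times, the KILL
interface `EventKills`, and the generic rows / floors / residual -/

/-- The order-1 jet space `ℝ³ × L(ℝ³, ℝ³)` (value, gradient). -/
abbrev Jet := E3 × (E3 →L[ℝ] E3)

/-- The **scale-invariant physical jet** of `u` at `(t, x)` before the candidate blow-up time `T` (viscosity `ν`):
`J_u(t,x) = ( √((T − t)/ν) · u(t,x) , (T − t) · ∇u(t,x) )` — dimensionless under the Navier–Stokes scaling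
`u ↦ λu(λ²t, λx)`, and EXACTLY the quantity the singular zoom freezes (`physJet_zoom`). -/
def physJet (T ν : ℝ) (u : ℝ → E3 → E3) (t : ℝ) (x : E3) : Jet :=
  (Real.sqrt ((T - t) / ν) • u t x, (T - t) • fderiv ℝ (u t) x)

/-- The **ancient jet** of a blow-up limit `W` at `(s, y)`, `s < 0`: `( √(−s) · W(s,y) , (−s) · ∇W(s,y) )`. -/
def ancientJet (W : ℝ → E3 → E3) (s : ℝ) (y : E3) : Jet :=
  (Real.sqrt (-s) • W s y, (-s) • fderiv ℝ (W s) y)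

/-- The **event slice** of an event `P ⊆ Jet` at time `t`: the set of points whose physical jet realises the event. -/
def eventSlice (P : Set Jet) (T ν : ℝ) (u : ℝ → E3 → E3) (t : ℝ) : Set E3 :=
  {x | physJet T ν u t x ∈ P}

/-- The **event fraction** `Φ_P(t) = vol(eventSlice P)(t) / (ν (T − t))^{3/2} ∈ [0, ∞]` (magnitude-blind, dimensionless). -/
def evFraction (P : Set Jet) (T ν : ℝ) (u : ℝ → E3 → E3) (t : ℝ) : ℝ≥0∞ :=
  volume (eventSlice P T ν u t) / parabVol T ν t

/-- The **`δ`-fat event times**: times `t ∈ [0, T)` at which the event slice has volume `> δ (ν (T − t))^{3/2}`. -/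
def evFatTimes (P : Set Jet) (T ν δ : ℝ) (u : ℝ → E3 → E3) : Set ℝ :=
  {t | t ∈ Ico 0 T ∧ ENNReal.ofReal δ * parabVol T ν t < volume (eventSlice P T ν u t)}

/-- **The KILL interface of the socket.**  An event `P` KILLS if every Type-I ancient mild field (class `𝒦_M`, any `M`)
whose ancient jet NEVER realises `P` is trivial.  Each instance below is a tree Liouville theorem read through this
interface; no kill is proved in this file. -/
def EventKills (P : Set Jet) : Prop :=
  ∀ (M : ℝ) (W : ℝ → E3 → E3), IsTypeIAncientMild M W → (∀ s < (0 : ℝ), ∀ y : E3, ancientJet W s y ∉ P) →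
    ∀ s < (0 : ℝ), ∀ y : E3, W s y = 0

/-- **Generic apex row «P-THIN TOP»**: in the frame of `Row_F1`, if for every `δ > 0` the `δ`-fat event times are
SCALE-NULL at `T`, the solution extends smoothly past `T`. -/
def EvRow (P : Set Jet) : Prop :=
  ∀ (ν T : ℝ), 0 < ν → 0 < T → ∀ (u : ℝ → E3 → E3) (p : ℝ → E3 → ℝ),
    IsClassicalNSSolutionOn (Ico 0 T) ν 0 u p → IsLerayHopfOn T ν 0 (u 0) u → HasRapidSpatialDecay (u 0) →
    IsTypeIBlowup u T → (∀ δ : ℝ, 0 < δ → IsScaleNull T (evFatTimes P T ν δ u)) → HasSmoothExtensionPast ν 0 u T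

/-- **Generic evanescent row «P-EVANESCENT TOP»**: `Φ_P(t) → 0` as `t ↑ T` suffices. -/
def EvRowVo (P : Set Jet) : Prop :=
  ∀ (ν T : ℝ), 0 < ν → 0 < T → ∀ (u : ℝ → E3 → E3) (p : ℝ → E3 → ℝ),
    IsClassicalNSSolutionOn (Ico 0 T) ν 0 u p → IsLerayHopfOn T ν 0 (u 0) u → HasRapidSpatialDecay (u 0) →
    IsTypeIBlowup u T → Tendsto (evFraction P T ν u) (𝓝[<] T) (𝓝 0) → HasSmoothExtensionPast ν 0 u T

/-- **Generic floor «P-FAT SLICES RECUR»**: a maximal Type-I blow-up has, for some `δ > 0`, `δ`-fat event times that are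
NOT scale-null at `T`. -/
def EvFloor (P : Set Jet) : Prop :=
  ∀ (ν T : ℝ), 0 < ν → 0 < T → ∀ (u : ℝ → E3 → E3) (p : ℝ → E3 → ℝ),
    IsMaximalSmoothSolution ν 0 u p T → IsLerayHopfOn T ν 0 (u 0) u → HasRapidSpatialDecay (u 0) →
    IsTypeIBlowup u T → ∃ δ : ℝ, 0 < δ ∧ ¬ IsScaleNull T (evFatTimes P T ν δ u)

/-- **Generic floor «P-PERSISTENT SLICE»**: a maximal Type-I blow-up has `Φ_P(t) ↛ 0`. -/
def EvFloorVo (P : Set Jet) : Prop :=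
  ∀ (ν T : ℝ), 0 < ν → 0 < T → ∀ (u : ℝ → E3 → E3) (p : ℝ → E3 → ℝ),
    IsMaximalSmoothSolution ν 0 u p T → IsLerayHopfOn T ν 0 (u 0) u → HasRapidSpatialDecay (u 0) →
    IsTypeIBlowup u T → ¬ Tendsto (evFraction P T ν u) (𝓝[<] T) (𝓝 0)

/-- **Generic residual «P-SLACK»**: a maximal Type-I blow-up has scale-null fat event times for every `δ`.  For a killing
open event this is EQUIVALENT to `Row_F1` (`evSlack_iff_rowF1`) — the summit-hard half, isolated, not claimed. -/
def EvSlack (P : Set Jet) : Prop :=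
  ∀ (ν T : ℝ), 0 < ν → 0 < T → ∀ (u : ℝ → E3 → E3) (p : ℝ → E3 → ℝ),
    IsMaximalSmoothSolution ν 0 u p T → IsLerayHopfOn T ν 0 (u 0) u → HasRapidSpatialDecay (u 0) →
    IsTypeIBlowup u T → ∀ δ : ℝ, 0 < δ → IsScaleNull T (evFatTimes P T ν δ u)

/-! ### Elementary properties -/

/-- Event-fat times lie in `[0, T)`. -/
theorem evFatTimes_subset_Ico (P : Set Jet) (T ν δ : ℝ) (u : ℝ → E3 → E3) : evFatTimes P T ν δ u ⊆ Ico 0 T :=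
  fun _ ht => ht.1

/-- Monotonicity of the fat event times in the event. -/
theorem evFatTimes_mono {P Q : Set Jet} (hPQ : P ⊆ Q) (T ν δ : ℝ) (u : ℝ → E3 → E3) :
    evFatTimes P T ν δ u ⊆ evFatTimes Q T ν δ u := by
  intro t ht
  refine ⟨ht.1, lt_of_lt_of_le ht.2 (measure_mono fun x hx => ?_)⟩
  exact hPQ hx

/-- Monotonicity of the fat event times in `δ`. -/
theorem evFatTimes_anti_delta (P : Set Jet) (T ν : ℝ) {δ δ' : ℝ} (h : δ ≤ δ') (u : ℝ → E3 → E3) :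
    evFatTimes P T ν δ' u ⊆ evFatTimes P T ν δ u := by
  intro t ht
  exact ⟨ht.1, lt_of_le_of_lt (mul_le_mul' (ENNReal.ofReal_le_ofReal h) le_rfl) ht.2⟩

/-- `EvRow` is antitone and `EvFloor` is monotone in the event. -/
theorem evRow_anti {P Q : Set Jet} (hPQ : P ⊆ Q) (h : EvRow P) : EvRow Q :=
  fun ν T hν hT u p hsol hLH hdec hTI hnull =>
    h ν T hν hT u p hsol hLH hdec hTI fun δ hδ => (hnull δ hδ).mono (evFatTimes_mono hPQ T ν δ u)

/-! ### The physical jet under the zoom: `J_u(t_j(s), x_j(y)) = ( √(−s)·(c_jα) u(…) , (−s)·(c_jα·c_jR) ∇u(…) )` -/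

/-- `α² ν = β` from `α √ν = √β`. -/
theorem alpha_sq_mul_nu {ν α β : ℝ} (hν : 0 < ν) (hβ : 0 < β) (hαν : α * Real.sqrt ν = Real.sqrt β) :
    α ^ 2 * ν = β := by
  have h := congrArg (fun r : ℝ => r ^ 2) hαν
  simp only [mul_pow, Real.sq_sqrt hν.le, Real.sq_sqrt hβ.le] at h
  exact h

/-- The amplitude factor of the rescaled time: `√((T − t_j(s))/ν) = √(−s) · (c_j α)`. -/
theorem sqrt_timeLag_div_nu {T ν α β : ℝ} {c : ℕ → ℝ} (hν : 0 < ν) (hβ : 0 < β)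
    (hαν : α * Real.sqrt ν = Real.sqrt β) (hα : 0 < α) (hcpos : ∀ j, 0 < c j) (j : ℕ) {s : ℝ} (hs : s < 0) :
    Real.sqrt ((T - (T + c j ^ 2 * β * s)) / ν) = Real.sqrt (-s) * (c j * α) := by
  have hs' : 0 < -s := neg_pos.2 hs
  have hα2 := alpha_sq_mul_nu hν hβ hαν
  have hcj := hcpos j
  refine Real.sqrt_eq_cases.2 (Or.inl ⟨?_, by positivity⟩)
  rw [eq_div_iff hν.ne']
  have h1 : Real.sqrt (-s) * Real.sqrt (-s) = -s := Real.mul_self_sqrt hs'.le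
  calc Real.sqrt (-s) * (c j * α) * (Real.sqrt (-s) * (c j * α)) * ν
      = (Real.sqrt (-s) * Real.sqrt (-s)) * c j ^ 2 * (α ^ 2 * ν) := by ring
    _ = T - (T + c j ^ 2 * β * s) := by rw [h1, hα2]; ring

/-- **The physical jet along the zoom converges to the ancient jet** (from the pointwise convergence of the rescaled
fields `hpt` and of their gradients `hgrad`, outputs of the singular zoom package). -/
theorem tendsto_physJet_zoom {T ν α β R : ℝ} {u : ℝ → E3 → E3} {x₀ : E3} {c : ℕ → ℝ} {W : ℝ → E3 → E3}
    (hν : 0 < ν) (hα : 0 < α) (hβ : 0 < β) (hαR : α * R = β) (hαν : α * Real.sqrt ν = Real.sqrt β)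
    (hcpos : ∀ j, 0 < c j)
    (hpt : ∀ t < 0, ∀ y : E3,
      Tendsto (fun j => (c j * α) • u (T + c j ^ 2 * β * t) (x₀ + (c j * R) • y)) atTop (𝓝 (W t y)))
    (hgrad : ∀ t < 0, ∀ y : E3,
      Tendsto (fun j => (c j * α * (c j * R)) • fderiv ℝ (u (T + c j ^ 2 * β * t)) (x₀ + (c j * R) • y)) atTop
        (𝓝 (fderiv ℝ (W t) y)))
    {s : ℝ} (hs : s < 0) (y : E3) :
    Tendsto (fun j => physJet T ν u (T + c j ^ 2 * β * s) (x₀ + (c j * R) • y)) atTop (𝓝 (ancientJet W s y)) := by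
  have hcc : ∀ j, c j * α * (c j * R) = c j ^ 2 * β := fun j => by rw [← hαR]; ring
  have e2 : ∀ j, T - (T + c j ^ 2 * β * s) = (-s) * (c j * α * (c j * R)) := fun j => by rw [hcc]; ring
  have h1 : Tendsto (fun j => Real.sqrt ((T - (T + c j ^ 2 * β * s)) / ν) • u (T + c j ^ 2 * β * s) (x₀ + (c j * R) • y))
      atTop (𝓝 (Real.sqrt (-s) • W s y)) := by
    have h := (hpt s hs y).const_smul (Real.sqrt (-s))
    refine h.congr fun j => ?_
    rw [sqrt_timeLag_div_nu hν hβ hαν hα hcpos j hs, smul_smul]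
  have h2 : Tendsto (fun j => (T - (T + c j ^ 2 * β * s)) • fderiv ℝ (u (T + c j ^ 2 * β * s)) (x₀ + (c j * R) • y))
      atTop (𝓝 ((-s) • fderiv ℝ (W s) y)) := by
    have h := (hgrad s hs y).const_smul (-s)
    refine h.congr fun j => ?_
    rw [e2 j, smul_smul]
  exact h1.prodMk_nhds h2

/-! ### Joint continuity of the ancient jet (the limit is smooth on `(−∞,0) × ℝ³`) -/

/-- The slice gradient `∇(W s)(y)` is the partial derivative of `uncurry W` in `y`: jointly continuous in `(s, y)`. -/
theorem continuousOn_fderiv_slice {C : ℝ} {W : ℝ → E3 → E3} (hW : IsTypeIAncientMild C W) :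
    ContinuousOn (fun q : ℝ × E3 => fderiv ℝ (W q.1) q.2) (Iio 0 ×ˢ univ) := by
  have hopen : IsOpen (Iio (0 : ℝ) ×ˢ (univ : Set E3)) := isOpen_Iio.prod isOpen_univ
  have hD : ContinuousOn (fun q : ℝ × E3 => fderiv ℝ (uncurry W) q) (Iio 0 ×ˢ univ) :=
    hW.1.continuousOn_fderiv_of_isOpen hopen (by simp)
  have hcomp : ContinuousOn (fun q : ℝ × E3 => (fderiv ℝ (uncurry W) q).comp (ContinuousLinearMap.inr ℝ ℝ E3))
      (Iio 0 ×ˢ univ) := hD.clm_comp continuousOn_const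
  refine hcomp.congr ?_
  rintro ⟨s, y⟩ hq
  have hdiff : DifferentiableAt ℝ (uncurry W) (s, y) :=
    (hW.1.differentiableOn (by simp)).differentiableAt (hopen.mem_nhds hq)
  have hinner : HasFDerivAt (fun y' : E3 => ((s, y') : ℝ × E3)) (ContinuousLinearMap.inr ℝ ℝ E3) y :=
    hasFDerivAt_prodMk_right s y
  have hc := hdiff.hasFDerivAt.comp y hinner
  have hfun : (uncurry W ∘ fun y' : E3 => ((s, y') : ℝ × E3)) = W s := by
    funext y'; rfl
  rw [hfun] at hc
  exact hc.fderiv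

/-- The ancient jet is jointly continuous on `(−∞, 0) × ℝ³`. -/
theorem continuousOn_ancientJet {C : ℝ} {W : ℝ → E3 → E3} (hW : IsTypeIAncientMild C W) :
    ContinuousOn (fun q : ℝ × E3 => ancientJet W q.1 q.2) (Iio 0 ×ˢ univ) := by
  have h1 : ContinuousOn (fun q : ℝ × E3 => Real.sqrt (-q.1) • W q.1 q.2) (Iio 0 ×ˢ univ) :=
    (continuous_fst.neg.sqrt.continuousOn).smul hW.1.continuousOn
  have h2 : ContinuousOn (fun q : ℝ × E3 => (-q.1) • fderiv ℝ (W q.1) q.2) (Iio 0 ×ˢ univ) :=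
    continuous_fst.neg.continuousOn.smul (continuousOn_fderiv_slice hW)
  exact h1.prodMk h2

/-- **Open events are realised on boxes**: if the ancient jet realises an OPEN event at `(s₀, y₀)`, `s₀ < 0`, it realises it
on a whole box `(s₀ − η, s₀ + η) × B(y₀, η)` of negative times. -/
theorem exists_box_event {C : ℝ} {W : ℝ → E3 → E3} (hW : IsTypeIAncientMild C W) {P : Set Jet} (hP : IsOpen P)
    {s₀ : ℝ} {y₀ : E3} (hs₀ : s₀ < 0) (h : ancientJet W s₀ y₀ ∈ P) :
    ∃ η : ℝ, 0 < η ∧ s₀ + η < 0 ∧ ∀ s ∈ Ioo (s₀ - η) (s₀ + η), ∀ y ∈ ball y₀ η, ancientJet W s y ∈ P := by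
  have hopen : IsOpen (Iio (0 : ℝ) ×ˢ (univ : Set E3)) := isOpen_Iio.prod isOpen_univ
  have hmem : (s₀, y₀) ∈ Iio (0 : ℝ) ×ˢ (univ : Set E3) := ⟨hs₀, mem_univ _⟩
  have hat : ContinuousAt (fun q : ℝ × E3 => ancientJet W q.1 q.2) (s₀, y₀) :=
    (continuousOn_ancientJet hW).continuousAt (hopen.mem_nhds hmem)
  have hU : {q : ℝ × E3 | ancientJet W q.1 q.2 ∈ P} ∈ 𝓝 (s₀, y₀) := hat.preimage_mem_nhds (hP.mem_nhds h)
  have hV : {q : ℝ × E3 | ancientJet W q.1 q.2 ∈ P} ∩ Iio (0 : ℝ) ×ˢ (univ : Set E3) ∈ 𝓝 (s₀, y₀) :=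
    inter_mem hU (hopen.mem_nhds hmem)
  obtain ⟨ε, hε, hball⟩ := Metric.mem_nhds_iff.1 hV
  refine ⟨ε / 2, by positivity, ?_, fun s hs y hy => ?_⟩
  · have hq : (s₀ + ε / 2, y₀) ∈ ball (s₀, y₀) ε := by
      rw [mem_ball, Prod.dist_eq, dist_self, Real.dist_eq]
      simp only [add_sub_cancel_left, abs_of_pos (half_pos hε)]
      exact max_lt (half_lt_self hε) hε
    exact (hball hq).2.1
  · have hq : (s, y) ∈ ball (s₀, y₀) ε := by
      rw [mem_ball, Prod.dist_eq]
      refine max_lt ?_ ?_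
      · rw [Real.dist_eq, abs_lt]; constructor <;> linarith [hs.1, hs.2]
      · exact lt_of_lt_of_le (mem_ball.1 hy) (by linarith)
    exact (hball hq).1

/-- **Eventual realisation along the zoom**: if the ancient jet realises the open event `P` at `(s, y)`, then the moving
point `x₀ + c_jR·y` lies in the event slice at the rescaled time `T + c_j²β s` for all large `j`. -/
theorem eventually_event {T ν α β R : ℝ} {u : ℝ → E3 → E3} {x₀ : E3} {c : ℕ → ℝ} {W : ℝ → E3 → E3}
    (hν : 0 < ν) (hα : 0 < α) (hβ : 0 < β) (hαR : α * R = β) (hαν : α * Real.sqrt ν = Real.sqrt β)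
    (hcpos : ∀ j, 0 < c j)
    (hpt : ∀ t < 0, ∀ y : E3,
      Tendsto (fun j => (c j * α) • u (T + c j ^ 2 * β * t) (x₀ + (c j * R) • y)) atTop (𝓝 (W t y)))
    (hgrad : ∀ t < 0, ∀ y : E3,
      Tendsto (fun j => (c j * α * (c j * R)) • fderiv ℝ (u (T + c j ^ 2 * β * t)) (x₀ + (c j * R) • y)) atTop
        (𝓝 (fderiv ℝ (W t) y)))
    {P : Set Jet} (hP : IsOpen P) {s : ℝ} (hs : s < 0) {y : E3} (h : ancientJet W s y ∈ P) :
    ∀ᶠ j in atTop, x₀ + (c j * R) • y ∈ eventSlice P T ν u (T + c j ^ 2 * β * s) :=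
  (tendsto_physJet_zoom hν hα hβ hαR hαν hcpos hpt hgrad hs y).eventually_mem (hP.mem_nhds h)

end Summit.NavierStokesRegularity.NavierStokesRegularity.Theorems.ScenarioCensus.EventSocket

end
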